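import Mathlib

/-!
# Degree bookkeeping for line `Sketch` of crux `CertWindowQP` (stmt-ValiantsHypothesis-5640)

Stub `stub_degArith` of the registered skeleton: for `n ≤ m` the Skoda–Brownawell degree bound
`(N+1)·(0+m)`, `N = (n²+1)m²` the number of unknowns of the system `Rep(n,m)`, is at most
`(m+2)^5`. Pure arithmetic (Mathlib only).
-/

namespace Summit.ValiantsHypothesis.ValiantsHypothesis.Theorems

/-- Degree bookkeeping for line `Sketch` of crux `CertWindowQP`: for `n ≤ m` the
Skoda–Brownawell bound `(N+1)·(0+m)`, `N = (n²+1)m²` the number of unknowns of `Rep(n,m)`, is at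
most `(m+2)^5`. -/
theorem certWindowQP_degArith (n m : ℕ) (hnm : n ≤ m) :
    (Fintype.card (Option (Fin n × Fin n) × (Fin m × Fin m)) + 1) * (0 + m) ≤ (m + 2) ^ 5 := by
  simp only [Fintype.card_prod, Fintype.card_option, Fintype.card_fin, zero_add]
  have h1 : n * n ≤ m * m := Nat.mul_le_mul hnm hnm
  calc ((n * n + 1) * (m * m) + 1) * m ≤ ((m * m + 1) * (m * m) + 1) * m := by gcongr
    _ ≤ (m + 2) ^ 5 := by ring_nf; omega

/-- **Registered stub `stub_degArith`** of line `Sketch` (crux `CertWindowQP`, stmt-ValiantsHypothesis-5640),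
verbatim signature of the registered skeleton `Cruxes/CertWindowQP/Lines/Sketch.lean`; proved by the
theorem above. -/
theorem stub_degArith (n m : ℕ) (hnm : n ≤ m) :
    (Fintype.card (Option (Fin n × Fin n) × (Fin m × Fin m)) + 1) * (0 + m) ≤ (m + 2) ^ 5 :=
  certWindowQP_degArith n m hnm

end Summit.ValiantsHypothesis.ValiantsHypothesis.Theorems
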